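import Literature.AnabelianGeometry.EtaleTheta.FrobenioidCyclotomicRigidityToy

/-!
# [EtTh] Prop. 5.5 / Thm. 5.6 as typed: universal closures REFUTED, satisfiability witnessed (toy, `n = 3`)

Mochizuki, *The étale theta function …*, Publ. RIMS **45** (2009), §5: Prop. 5.5 PRIMS p.327 (PDF p.101),
Thm. 5.6 p.328 (PDF p.102) [cite: MochizukiEtTh2009, Prop 5.5 p.327 (PDF p.101); Thm 5.6 p.328 (PDF p.102)].
abc-iut cell, block F, seat abc-iut-f-118.  PROOF-ONLY companion of `FrobenioidCyclotomicRigidityToy.lean`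
(the closed toy §5 datum `toy n s`, its saturation `isThetaSaturated`, the free stub `projToy`, the
canonical candidate family `rho`, the sections `1` / `sInr`) deciding the FROZEN FACT-LIST schema rows
**F-0526** (`FrobenioidCyclotomicRigidity.CyclotomicRigidity`), **F-0527** (`CyclotomicRigidityPreserved`),
**F-0530** (`PreservesRigidityIso`) under plan rule R5 (a universal closure of a schema row is not a fact):

* `not_forall_cyclotomicRigidity` (F-0526): at `toy 3 1` (`s^⊓-gp = 1 = s^⊔-gp`) NO rigidity family is
  Kummer-determined — the typed clause forces `ρ_{B_N}(g₀²) = s^⊓-gp · (s^⊔-gp)⁻¹ = 1` for an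
  isomorphism `ρ_{B_N}` — so the existence half of the typed Prop. 5.5 fails and its closure is FALSE;
* `not_forall_preservesRigidityIso` (F-0530), `not_forall_cyclotomicRigidityPreserved` (F-0527): for
  `Ψ = id` and the type-correct but WRONG transport `aΨ = inversion` of `(l·Δ_Θ)_S ⊗ ℤ/3` the transport
  equation of the typed Thm. 5.6 reads `(1, g₀) = (1, g₀⁻¹)` — the free parameter `aΨ` makes the
  closures FALSE;
* satisfiability (consistency of the typed statements at a CLOSED instance): `rho_isFunctorialLinear`,
  `isKummerDetermined_rho`, `cyclotomicRigidity_toy` (Prop. 5.5 HOLDS at `toy 3 sInr`: existence by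
  `rho`, uniqueness because `H_{B_N} ↠ (l·Δ_Θ)_{B_N} ⊗ ℤ/3` pins `ρ_{B_N}` and `B_N` is the only object),
  `cyclotomicRigidityPreserved_refl` (Thm. 5.6 HOLDS for `Ψ = id`, `aΨ = id`, any `n`, `s`).

Outcome per row: «universal-closure REFUTED / schema; instance forms model-witnessed (toy)» — each is an
assumption about NAMED §5 data only; the genuine instances are the business of the L2/L6 discharge chain
(`cyclotomicRigidity_ofBiKummerData_of_laws`, `cyclotomicRigidityPreserved_of`, …), untouched here.
HONEST FRAMING: kernel statements about OUR typed interface at a toy; nothing here bears on, or takes a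
side on, [IUTchIII] Cor. 3.12 or [EtTh] itself; a FACT row is an assumption label; typed ≠ proved.
-/

namespace Literature.AnabelianGeometry.EtaleTheta

namespace CyclotomicRigidityToy

open CategoryTheory
open Literature.AlgebraicGeometry.Frobenioids FrobenioidCyclotomicRigidity

section Toy

variable (n : ℕ+) (s : Aut (SingleObj.star (Gn n)) →* Aut (SingleObj.star (Gn n × Gn n)))

/-- **`rho` is functorial for linear morphisms** (all transports of the toy are identities).
[cite: MochizukiEtTh2009, Prop 5.5 p.327 (PDF p.101)] -/
theorem rho_isFunctorialLinear : IsFunctorialLinear (toy n s) (rho n s) := by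
  intro S T φ _ hS hT x
  induction x using QuotientGroup.induction_on with
  | H g => rfl

/-- **With `s^⊓-gp = sInr`, `rho` is Kummer-determined** ("the second Kummer class … determines" it).
[cite: MochizukiEtTh2009, Prop 5.5 p.327 (PDF p.101)] -/
theorem isKummerDetermined_rho (hB : (toy n (sInr n)).IsThetaSaturated (toy n (sInr n)).BN) :
    IsKummerDetermined (toy n (sInr n)) (projToy n (sInr n)) (rho n (sInr n)) hB := by
  intro h hh
  rw [sgpCap_apply, sgpCup_apply, inv_one, mul_one]
  exact Iso.ext rfl

/-- `Ψ = id` preserves the theta-saturated objects (first clause of Thm. 5.6 at the toy, tautological).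
[cite: MochizukiEtTh2009, Thm 5.6 p.328 (PDF p.102)] -/
theorem preservesThetaSaturated_refl : PreservesThetaSaturated (toy n s) CategoryTheory.Equivalence.refl :=
  fun _ => Iff.rfl

/-- `Ψ = id` preserves the cyclotomes. [cite: MochizukiEtTh2009, Thm 5.6 proof p.328 (PDF p.102)] -/
theorem preservesCyclotomes_refl : PreservesCyclotomes (toy n s) CategoryTheory.Equivalence.refl :=
  fun _ _ hu => hu

/-- **Satisfiability of the typed Thm. 5.6, second clause**: for `Ψ = id` with the identity transport
`aΨ = id`, `rho` is transported to itself. [cite: MochizukiEtTh2009, Thm 5.6 p.328 (PDF p.102)] -/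
theorem preservesRigidityIso_refl :
    PreservesRigidityIso (toy n s) CategoryTheory.Equivalence.refl (rho n s) (fun S => MulEquiv.refl ((toy n s).lDeltaModN S)) :=
  ⟨preservesCyclotomes_refl n s, fun _ _ _ _ => rfl⟩

/-- **Satisfiability of the typed Thm. 5.6 (both clauses)** at the toy, `Ψ = id`, `aΨ = id`.
[cite: MochizukiEtTh2009, Thm 5.6 p.328 (PDF p.102)] -/
theorem cyclotomicRigidityPreserved_refl :
    CyclotomicRigidityPreserved (toy n s) CategoryTheory.Equivalence.refl (rho n s)
      (fun S => MulEquiv.refl ((toy n s).lDeltaModN S)) :=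
  ⟨preservesThetaSaturated_refl n s, preservesRigidityIso_refl n s⟩

end Toy

/-! ### `n = 3`: the three universal closures are FALSE; Prop. 5.5 holds with the right section -/

section Three

variable (s : Aut (SingleObj.star (Gn 3)) →* Aut (SingleObj.star (Gn 3 × Gn 3)))

/-- `g₀² ≠ 1` in `ℤ/3`. [cite: MochizukiEtTh2009, §5 p.331 (PDF p.105)] -/
theorem g0_sq_ne_one : g0 3 ^ (2 * (1 : ℤ)) ≠ 1 := by decide

/-- **(F-0526) With `s^⊓-gp = 1 = s^⊔-gp` NO rigidity family is Kummer-determined**: the typed clause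
forces `ρ_{B_N}(g₀²) = s^⊓-gp(ρ(0,2)) · s^⊔-gp(ρ(0,2))⁻¹ = 1`, but `ρ_{B_N}` is injective and `g₀² ≠ 1`
in `(l·Δ_Θ)_{B_N} ⊗ ℤ/3 = ℤ/3`. [cite: MochizukiEtTh2009, Prop 5.5 p.327 (PDF p.101)] -/
theorem not_isKummerDetermined_one (ρ : RigidityFamily (toy 3 1))
    (hB : (toy 3 1).IsThetaSaturated (toy 3 1).BN) :
    ¬ IsKummerDetermined (toy 3 1) (projToy 3 1) ρ hB := by
  intro hK
  have h := hK ⟨_, rho2k_mem_HB 3 1 1⟩ (Subgroup.mem_top _)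
  have h0 := h.trans (Iso.ext rfl : _ = (1 : Aut (toy 3 1).BN))
  have h1 := (MulEquiv.map_eq_one_iff _).mp (OneMemClass.coe_eq_one.mp h0)
  have h2 := congrArg (lDeltaModNEquiv 3 1 _) h1
  rw [map_one] at h2
  exact g0_sq_ne_one h2

/-- **(F-0526) The typed Prop. 5.5 FAILS at the toy with `s^⊓-gp = 1`** (its existence half).
[cite: MochizukiEtTh2009, Prop 5.5 p.327 (PDF p.101)] -/
theorem not_cyclotomicRigidity_toy (hB : (toy 3 1).IsThetaSaturated (toy 3 1).BN) :
    ¬ CyclotomicRigidity (toy 3 1) (projToy 3 1) hB := by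
  rintro ⟨⟨ρ, hK, -⟩, -⟩
  exact not_isKummerDetermined_one ρ hB hK

/-- **(F-0526) The UNIVERSAL CLOSURE of `FrobenioidCyclotomicRigidity.CyclotomicRigidity` is FALSE**
(instance counterexample `toy 3 1`, `projToy`): the schema is an assumption about NAMED §5 data only (R5).
[cite: MochizukiEtTh2009, Prop 5.5 p.327 (PDF p.101)] -/
theorem not_forall_cyclotomicRigidity :
    ¬ ∀ (C : Type) [Category.{0} C] (D : Type) [Category.{0} D] (𝔉 : ThetaFrobenioid.{0} C D)
      (P : ThetaSubquotientProj 𝔉) (hB : 𝔉.IsThetaSaturated 𝔉.BN), CyclotomicRigidity 𝔉 P hB :=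
  fun h => not_cyclotomicRigidity_toy (isThetaSaturated 3 1 _) (h _ _ (toy 3 1) (projToy 3 1) _)

/-- **(F-0530) The transport clause of the typed Thm. 5.6 FAILS for `Ψ = id` with the type-correct but
WRONG transport `aΨ = inversion`**: at `g₀` it reads `(1, g₀) = (1, g₀⁻¹)` in `Aut_C(B_N)`.
[cite: MochizukiEtTh2009, Thm 5.6 p.328 (PDF p.102)] -/
theorem not_preservesRigidityIso_toy :
    ¬ PreservesRigidityIso (toy 3 s) CategoryTheory.Equivalence.refl (rho 3 s) (fun S => MulEquiv.inv ((toy 3 s).lDeltaModN S)) := by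
  rintro ⟨-, h⟩
  have h1 := h (SingleObj.star _) (isThetaSaturated 3 s _) (isThetaSaturated 3 s _)
    (QuotientGroup.mk (g0 3))
  have h2 : g0 3 = (g0 3)⁻¹ := congrArg (fun a : Aut (SingleObj.star (Gn 3 × Gn 3)) => a.hom.2) h1
  have h3 : g0 3 ≠ (g0 3)⁻¹ := by decide
  exact h3 h2

/-- **(F-0527) Hence the typed Thm. 5.6 (both clauses) FAILS at the same parameters.**
[cite: MochizukiEtTh2009, Thm 5.6 p.328 (PDF p.102)] -/
theorem not_cyclotomicRigidityPreserved_toy :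
    ¬ CyclotomicRigidityPreserved (toy 3 s) CategoryTheory.Equivalence.refl (rho 3 s)
      (fun S => MulEquiv.inv ((toy 3 s).lDeltaModN S)) :=
  fun h => not_preservesRigidityIso_toy s h.2

/-- **(F-0530) The UNIVERSAL CLOSURE of `FrobenioidCyclotomicRigidity.PreservesRigidityIso` is FALSE**
(instance counterexample: `toy 3 1`, `Ψ = id`, `rho`, `aΨ = inversion`) — the transport `aΨ` is a free
parameter of the schema (R5). [cite: MochizukiEtTh2009, Thm 5.6 p.328 (PDF p.102)] -/
theorem not_forall_preservesRigidityIso :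
    ¬ ∀ (C : Type) [Category.{0} C] (D : Type) [Category.{0} D] (𝔉 : ThetaFrobenioid.{0} C D)
      (Ψ : C ≌ C) (ρ : RigidityFamily 𝔉) (aΨ : ∀ S : C, 𝔉.lDeltaModN S ≃* 𝔉.lDeltaModN (Ψ.functor.obj S)),
      PreservesRigidityIso 𝔉 Ψ ρ aΨ :=
  fun h => not_preservesRigidityIso_toy 1 (h _ _ (toy 3 1) _ (rho 3 1) _)

/-- **(F-0527) The UNIVERSAL CLOSURE of `FrobenioidCyclotomicRigidity.CyclotomicRigidityPreserved` is
FALSE** (same counterexample). [cite: MochizukiEtTh2009, Thm 5.6 p.328 (PDF p.102)] -/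
theorem not_forall_cyclotomicRigidityPreserved :
    ¬ ∀ (C : Type) [Category.{0} C] (D : Type) [Category.{0} D] (𝔉 : ThetaFrobenioid.{0} C D)
      (Ψ : C ≌ C) (ρ : RigidityFamily 𝔉) (aΨ : ∀ S : C, 𝔉.lDeltaModN S ≃* 𝔉.lDeltaModN (Ψ.functor.obj S)),
      CyclotomicRigidityPreserved 𝔉 Ψ ρ aΨ :=
  fun h => not_cyclotomicRigidityPreserved_toy 1 (h _ _ (toy 3 1) _ (rho 3 1) _)

/-- Every element of `ℤ/3` is an even power of `g₀`. [cite: MochizukiEtTh2009, §5 p.331 (PDF p.105)] -/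
theorem exists_zpow_eq (g : Gn 3) : ∃ k : ℤ, g0 3 ^ (2 * k) = g := by
  have : ∀ g : Gn 3, ∃ k ∈ ({0, 1, 2} : Finset ℤ), g0 3 ^ (2 * k) = g := by decide
  obtain ⟨k, -, hk⟩ := this g
  exact ⟨k, hk⟩

/-- `H_{B_N} = ρ({0} × 2ℤ)` is ALL of `Aut_D(B_N^bs) ≅ ℤ/3` (so it covers `(l·Δ_Θ)_{B_N} ⊗ ℤ/3`).
[cite: MochizukiEtTh2009, §5 p.331 (PDF p.105)] -/
theorem exists_mem_HB (g : Gn 3) :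
    ∃ h : Aut ((toy 3 s).base.obj (toy 3 s).BN), h ∈ (toy 3 s).HB ∧ h.hom = g := by
  obtain ⟨k, hk⟩ := exists_zpow_eq g
  exact ⟨_, rho2k_mem_HB 3 s k, hk⟩

/-- **Satisfiability of the typed Prop. 5.5**: with `s^⊓-gp = sInr` it HOLDS at the toy (`n = 3`) —
existence by `rho`, uniqueness because a Kummer-determined family is pinned on `H_{B_N} ↠ ℤ/3` and `B_N` is
the only object. [cite: MochizukiEtTh2009, Prop 5.5 p.327 (PDF p.101)] -/
theorem cyclotomicRigidity_toy (hB : (toy 3 (sInr 3)).IsThetaSaturated (toy 3 (sInr 3)).BN) :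
    CyclotomicRigidity (toy 3 (sInr 3)) (projToy 3 (sInr 3)) hB := by
  refine ⟨⟨rho 3 _, isKummerDetermined_rho 3 hB, rho_isFunctorialLinear 3 _⟩, ?_⟩
  intro ρ ρ' hK _ hK' _
  funext S hS
  obtain ⟨⟩ := S
  apply MulEquiv.ext
  intro x
  induction x using QuotientGroup.induction_on with
  | H g =>
    obtain ⟨h, hh, rfl⟩ := exists_mem_HB (sInr 3) g
    exact Subtype.ext ((hK ⟨h, hh⟩ (Subgroup.mem_top _)).trans (hK' ⟨h, hh⟩ (Subgroup.mem_top _)).symm)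

end Three

end CyclotomicRigidityToy

end Literature.AnabelianGeometry.EtaleTheta
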